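import Summits.HodgeConjecture.CorCM.HypLiu418.A3Liu418GSFrobeniusOfThmD6Fold
import HarnessLib

/-!
# GS-6 from [Liu2021, Thm. D.6 (1)] for one curve: `frobeniusActsByGS_of_thmD6 (hD6 : thmD6OneCurveCUF) : frobeniusActsByGS`

The head of the GS-6 hoist, over the texts of `A3Liu418GSThmD6OneCurve` (`thmD6OneCurveCUF`, `DecompositionAtFace`,
`DecompositionAtFaceAdapted`, `UVat`):

* §1 **`frobeniusActsByGS_of_pieces₂ (hD6 : thmD6OneCurveCUF) (h : DecompositionAtFace) : frobeniusActsByGS`** — the see-saw assembly of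
  [Liu2021, Thm. 4.15 proof l. 2199–2212]: the degenerate sign branch `¬ 0 < Re ι₁(J⊥₀₀)` is EMPTY (no curve record exists there:
  `A3Liu418GSFrameDefinite`, `gsFrame_false_of_neg` / `gsFrame_re_subformRight_ne_zero`); on the printed branch `Sv` from `hD6` ONCE at
  `t := a′⁻¹`, joint injectivity of the projectors `P i`, `P i` commutes past `σ`, `P i ∘ f′ = g ∘ q i`, and the scalar identity on `g`
  from `hD6` on the slices `u ↦ g (u ⊗ m)` (`TensorProduct.induction_on`);
* §2 the transfer `decompositionAtFace_of_adapted : DecompositionAtFaceAdapted → DecompositionAtFace` (`q i ↦ q i ∘ Ψ`, `f′ ↦ f′ ∘ Ψ⁻¹`;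
  pull-back of a Hom-space along an intertwiner, `OmegaHomTransfer.comp_mem_omegaHom`) and `frobeniusActsByGS_of_pieces₃`;
* §3 **`DecompositionAtFaceAdapted_of_stubT (hT : chiSplittingFrameTransport) (hR : seesawCharChiSplittingLineTrivial)`** — THE FOLD:
  for every face prefix and admissible label `ε = epsOf e`, the frame choice (`gsFrame_exists_diagFrame`) gives `(g⋆, dJ)`; the adapted
  frame is `(dJ ‖ a′⁻¹J⊥₀₀, ι_{D′})`; the transport `(Ψ, hΨ)` is `exists_faceTransport_of_stubT hT`; the `H¹`-side projectors are the
  occurring central-weight projections, the labels `(epsOf (2i)⁻¹ (−e), occChi)`; the multiplicity modules, the maps `q i` and the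
  factorisation are the central plug at the split datum `diag dJ ⊕ᶠ diag (a′⁻¹J⊥₀₀)` (`exists_plugTail`, `hχV` from node R, centre fixed
  by `θ := (finAdelicCongr g⋆)⁻¹`) behind the face cast `exists_omegaFaceCast` — i.e. `ω(ν,ε,χ)|_{U(V⋆)} = ⊕_i ω⋆(ν,ε_i,χ_i) ⊗ M_i`
  ([Liu2021, Rem. D.5]) at the adapted frame;
* §4 **`decompositionAtFaceAdapted_holds`** (zero hypotheses: `chiSplittingFrameTransport_holds`, `seesawCharChiSplittingLineTrivial_holds`)
  and the head **`frobeniusActsByGS_of_thmD6 (hD6 : thmD6OneCurveCUF) : frobeniusActsByGS`**.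

THEOREMS ONLY.  Exposure notes for the named fact `thmD6OneCurveCUF` (≤ print) are in its docstring; GS-6's own docstring sentence
«J⊥ totally positive by hτa» is inaccurate — `hτa` constrains `a′` only, and the complement sign is handled here by §1 (vacuous branch)
and by the `hpos` binder of the package (printed branch).

PRE-SPLIT (director hodgecm-mathlib s168 (1)(d) ∕ s177 ∕ s178 (3), A-plan1 (g13) 19:14:52Z «every filed piece ≤ 250 check-node
CPU-s»; cutter A-p18 (g10)): A-p17 (g7/g8)՚s report-first `A3Liu418GSFrobeniusOfThmD6` b02ca771e6e9ad41 (349 l., ≈ 390 CPU-s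
synchronous on a check node) is filed as the 3-module chain `A3Liu418GSFrobeniusOfThmD6Pieces` (§1–§2) →
`A3Liu418GSFrobeniusOfThmD6Fold` (§3) → `A3Liu418GSFrobeniusOfThmD6` (§4, the head, module name KEPT for the β registry import);
every declaration (statement, proof, docstring, `set_option … in` line) is BYTE-IDENTICAL to b02ca771, same namespace
`Summit.HodgeConjecture.CorCM.Lines.A3Liu418`, unchanged fully-qualified names; the file-level `open` block is repeated per module.
This HEAD module keeps only §4 (`decompositionAtFaceAdapted_holds`, `frobeniusActsByGS_of_thmD6`) over
`A3Liu418GSFrobeniusOfThmD6Fold` → `A3Liu418GSFrobeniusOfThmD6Pieces`; §1–§3 live there verbatim.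

## References
* [Liu2021] Y. Liu, *Fourier–Jacobi cycles and arithmetic relative trace formula* (FJcycle.tex), Camb. J. Math. 9 (2021) = arXiv:2102.11518:
  Thm. 4.15 proof p. 51 (l. 2193–2212); §4.2 (l. 2162–2165); App. D: Rem. D.5 p. 131, Thm. D.6 (1) p. 132 (l. 5433–5443).
-/

set_option autoImplicit false

noncomputable section

open scoped TensorProduct Matrix NumberField Kronecker ComplexOrder
open NumberField NumberField.InfinitePlace IsDedekindDomain
open Summit.HodgeConjecture.CorCM.Model
open Summit.HodgeConjecture.CorCM.Model.HComp Summit.HodgeConjecture.CorCM.HComp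
open Literature.AlgebraicGeometry.Motives (CMType)
open Literature.AlgebraicGeometry.ShimuraVarieties.UnitaryCanonicalModel
open Literature.NumberTheory.Automorphic Literature.NumberTheory.Automorphic.UnitaryGroup
open Literature.NumberTheory.Automorphic.IdeleClassGroup
open Literature.NumberTheory.Automorphic.Liu2021 Literature.NumberTheory.Automorphic.Liu2021.AppendixC
open Literature.NumberTheory.GaloisRepresentations
open Literature.AlgebraicGeometry.Liu2021 (IsAdmissibleElement)
open Literature.RepresentationTheory.Liu2021
open Literature.RepresentationTheory.HarrisKudlaSweet1996
open Literature.NumberTheory.Weil1964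
open Literature.NumberTheory.GelbartRogawski1991
open Literature.NumberTheory.GelbartRogawski1991.UnitaryDualPair
open Literature.NumberTheory.GelbartRogawski1991.UnitaryDualPair.WeilCoinv
open Literature.NumberTheory.GelbartRogawski1991.UnitaryDualPair.LocalSplitting
open Literature.NumberTheory.Automorphic.Liu2021.Def411WeilCarriersDoubling
open Literature.NumberTheory.Automorphic.Liu2021.Def411WeilCarriers (TW JW JW_eq isSymm_TW isUnit_det_TW Rep Eps epsOf Chi)
open Literature.NumberTheory.Automorphic.Liu2021.Def411WeilCarriers (rhoVAtLine)

namespace Summit.HodgeConjecture.CorCM.Lines.A3Liu418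

/-! ## §4 The decomposition at the adapted frame holds, and the head -/

/-- **The decomposition package at the adapted frame `D′ = B·(g⋆ ⊕ 1)` HOLDS** (zero hypotheses): the fold
`DecompositionAtFaceAdapted_of_stubT` at frame independence of the χ-attached Weil representation
(`chiSplittingFrameTransport_holds`, `Def411WeilCarriersFrameTransportHolds`) and the triviality of the see-saw character on the
χ-splitting line (`seesawCharChiSplittingLineTrivial_holds`, `Def411WeilCarriersDoublingSeesawLine`).
[cite: Liu2021, Thm. 4.15 proof l. 2199–2212; Rem. D.5 p. 131] [cite: GelbartRogawski1991, §3.1 Prop. 3.1.1 p. 455] -/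
theorem decompositionAtFaceAdapted_holds : DecompositionAtFaceAdapted :=
  DecompositionAtFaceAdapted_of_stubT chiSplittingFrameTransport_holds seesawCharChiSplittingLineTrivial_holds

/-- **GS-6 FROM [Liu2021, Thm. D.6 (1)] FOR ONE CURVE**: `thmD6OneCurveCUF → frobeniusActsByGS`.
[cite: Liu2021, Thm. 4.15 proof l. 2193–2212; Thm. D.6 (1) p. 132; Rem. D.5 p. 131] -/
theorem frobeniusActsByGS_of_thmD6 (hD6 : thmD6OneCurveCUF) : frobeniusActsByGS :=
  frobeniusActsByGS_of_pieces₃ hD6 decompositionAtFaceAdapted_holds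

end Summit.HodgeConjecture.CorCM.Lines.A3Liu418

end
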